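import Summits.RiemannHypothesis.RiemannHypothesis.Theorems.PfPersistenceEntryTubes
import Summits.RiemannHypothesis.RiemannHypothesis.Theorems.PfPersistenceExpSumVanishing
import Summits.RiemannHypothesis.RiemannHypothesis.Theorems.PfPersistenceArithDialSpace
import HarnessLib

/-!
# The dial-space TRACE of a thin entry tube about `ζ` is `{ζ}`; G1-cont EXISTENCE ≡ `𝒫`-membership of `ζ`
# (pub-rhpf, barrier-typer gen 9)

**HONEST FRAMING. This is a long-odds MECHANISM SEARCH; no RH claims.** Nothing here proves, assumes or approaches
RH: both sides of every equivalence below are OPEN statements; the theorems are RH-free TYPING results.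

`PfPersistenceEntryTubes` reduced "does a G1-cont criterion separate `ζ` from the negatives of `D`?" to a radius
profile (`exists_inG1cont_separates_iff` ↔ `BoxIsolated D ζ`), sandwiched between `ζ ∈ 𝒫⁺` and `ζ ∈ 𝒫`. This file
CLOSES the sandwich on every dial domain `ζ ∈ D ⊆ dialSpace` (in particular `arithDialSpace`):
* §1 SAMPLING WINDOWS `samplingWindow Q N = ⟨log(Q + 3/2)/2, N⟩` (`e^{2a} = Q + 3/2`: positions in range are
  `q ≤ Q + 1`, none at the support edge, no two with `q q' = e^{2a}`); the `(0, N)` entry of `d_w − d_{w₀}` there is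
  the SINE SAMPLE `(√2/(πN)) Σ_{q ≤ Q+1} (w − w₀)(q) sin(N ω_q)`, `ω_q = 2π log q / log(Q + 3/2) ∈ (0, 2π)` pairwise
  distinct with `ω_q + ω_q' ≠ 2π` (PROVED).
* §2 HEIGHT-`Q` SAMPLING LEMMA (PROVED `weights_eq_of_close_at_samplingWindows`): entries `< ρ_N` with `N ρ_N → 0`
  force `w(q) = w₀(q)` for EVERY `2 ≤ q ≤ Q + 1` — from ONE height — by the landed sine-sum vanishing lemma
  `sinSum_coeff_eq_zero` (Vandermonde); the lag-`0` slots `0, 1` are fixed up to their sum at order `0`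
  (`weights_sum01_eq_of_close`), which is all the datum sees (`datumOf_eq_of_weights_eq`).
* §3 TRACE THEOREM (PROVED `datumOf_eq_of_mem_entryTube_of_thin`): for a profile THIN along the sampling family
  (`N · r(samplingWindow Q N) → 0` for every `Q`; e.g. `thinProfile = 1/(N+1)²`), `entryTube r ζ ∩ dialSpace = {ζ}`.
* §4 HEADLINE (PROVED `exists_inG1cont_separates_iff_allWindowsPositive`): for `ζ ∈ D ⊆ dialSpace`,
  `(∃ S, InG1cont S ∧ Separates S D ζ) ↔ AllWindowsPositive ζ` (also window-wise open `S`, `BoxIsolated`); schema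
  form `barrier_schema_iff_of_thinTube_mem`: T0 (`pfPersistence_criterion_in_C_iff_weilPositivity`) for EVERY class
  `𝒞 ∋ entryTube thinProfile ζ`, no `𝒫 ∈ 𝒞` needed. EXISTENCE of a separating G1-cont criterion on an arithmetic
  domain is EXACTLY Galerkin–Weil positivity of `ζ`, witnessed by a criterion with TRIVIAL arithmetic trace.
* §5 THE U-CLAUSE KILLS THIN TUBES (PROVED `not_dialEscape_entryTube_of_thin`): `N · r(samplingWindow 1 N) → 0` ⟹
  `¬ DialEscape (entryTube r ζ)` (the `2`-dial cannot escape below height `log(5/2)/2`); so height floors are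
  NECESSARY for G1-contU entry tubes (cand-6's `dialEscape_tube`: sufficient) — the floored stratum is typed in the
  companion mean-square file.
-/

set_option linter.dupNamespace false  -- the mandated namespace repeats `RiemannHypothesis`

noncomputable section

open Real Finset Matrix Filter Topology

namespace Summit.RiemannHypothesis.RiemannHypothesis.Theorems.PfPersistence

/-! ## §1 Sampling windows and the sine-sample identity -/

/-- PROVED: `1 < Q + 3/2`. [folklore] -/
theorem one_lt_samplingTop (Q : ℕ) : (1 : ℝ) < (Q : ℝ) + 3 / 2 := by
  have : (0 : ℝ) ≤ Q := Nat.cast_nonneg Q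
  linarith

/-- The SAMPLING LENGTH `ℓ_Q = log(Q + 3/2)` (`= 2 a_Q`). [folklore] -/
def samplingLog (Q : ℕ) : ℝ := Real.log ((Q : ℝ) + 3 / 2)

/-- PROVED: `ℓ_Q > 0`. [folklore] -/
theorem samplingLog_pos (Q : ℕ) : 0 < samplingLog Q := Real.log_pos (one_lt_samplingTop Q)

/-- The SAMPLING WINDOW of order `Q` and rank `N`: half-length `a_Q = log(Q + 3/2)/2`. [folklore] -/
def samplingWindow (Q N : ℕ) : Window := ⟨samplingLog Q / 2, N, div_pos (samplingLog_pos Q) two_pos⟩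

/-- PROVED: the rank field. [folklore] -/
@[simp] theorem samplingWindow_N (Q N : ℕ) : (samplingWindow Q N).N = N := rfl
/-- PROVED: `2 a_Q = ℓ_Q`. [folklore] -/
theorem two_mul_samplingWindow_a (Q N : ℕ) : 2 * (samplingWindow Q N).a = samplingLog Q := by
  show 2 * (samplingLog Q / 2) = samplingLog Q
  ring

/-- PROVED: exactly the positions `q ≤ Q + 1` are in range at the sampling window (`⌊Q + 3/2⌋ = Q + 1`). [folklore] -/
theorem primeRange_samplingWindow (Q N : ℕ) : primeRange (2 * (samplingWindow Q N).a) = Finset.range (Q + 2) := by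
  rw [two_mul_samplingWindow_a, primeRange, samplingLog, Real.exp_log (by linarith [one_lt_samplingTop Q])]
  have : ⌊(Q : ℝ) + 3 / 2⌋₊ = Q + 1 := by
    rw [Nat.floor_eq_iff (by linarith [one_lt_samplingTop Q])]
    push_cast
    constructor <;> linarith
  rw [this]

/-- The SAMPLING ANGLE of position `q` at order `Q`: `ω_q = 2π log q / ℓ_Q`. [folklore] -/
def samplingAngle (Q q : ℕ) : ℝ := 2 * π * Real.log q / samplingLog Q

/-- PROVED: slot `0` has angle `0` (`log 0 = 0`). [folklore] -/
theorem samplingAngle_zero (Q : ℕ) : samplingAngle Q 0 = 0 := by simp [samplingAngle]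

/-- PROVED: slot `1` has angle `0`. [folklore] -/
theorem samplingAngle_one (Q : ℕ) : samplingAngle Q 1 = 0 := by simp [samplingAngle]

/-- PROVED: `ω_q > 0` for `q ≥ 2`. [folklore] -/
theorem samplingAngle_pos (Q : ℕ) {q : ℕ} (hq : 2 ≤ q) : 0 < samplingAngle Q q := by
  have := Real.log_pos (show (1 : ℝ) < q by exact_mod_cast (lt_of_lt_of_le one_lt_two hq))
  have := samplingLog_pos Q
  unfold samplingAngle; positivity

/-- PROVED: `log q < ℓ_Q` for `q ≤ Q + 1` (no position at the support edge). [folklore] -/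
theorem log_lt_samplingLog (Q : ℕ) {q : ℕ} (hq : q ≤ Q + 1) : Real.log q < samplingLog Q := by
  rcases Nat.eq_zero_or_pos q with rfl | hq0
  · simp only [Nat.cast_zero, Real.log_zero]; exact samplingLog_pos Q
  · have : (q : ℝ) ≤ Q + 1 := by exact_mod_cast hq
    exact Real.log_lt_log (by exact_mod_cast hq0) (by linarith)

/-- PROVED: `ω_q < 2π` for `q ≤ Q + 1`. [folklore] -/
theorem samplingAngle_lt_two_pi (Q : ℕ) {q : ℕ} (hq : q ≤ Q + 1) : samplingAngle Q q < 2 * π := by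
  unfold samplingAngle
  rw [div_lt_iff₀ (samplingLog_pos Q)]
  exact mul_lt_mul_of_pos_left (log_lt_samplingLog Q hq) (by positivity)

/-- PROVED: the angles of positions `≥ 1` are pairwise distinct. [folklore] -/
theorem samplingAngle_inj (Q : ℕ) {q q' : ℕ} (hq : 1 ≤ q) (hq' : 1 ≤ q')
    (h : samplingAngle Q q = samplingAngle Q q') : q = q' := by
  unfold samplingAngle at h
  have hℓ := samplingLog_pos Q
  rw [div_left_inj' hℓ.ne'] at h
  have h' : Real.log q = Real.log q' := mul_left_cancel₀ (by positivity : (2 : ℝ) * π ≠ 0) h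
  have hqpos : (0 : ℝ) < q := by exact_mod_cast hq
  have hq'pos : (0 : ℝ) < q' := by exact_mod_cast hq'
  have := Real.log_injOn_pos (Set.mem_Ioi.2 hqpos) (Set.mem_Ioi.2 hq'pos) h'
  exact_mod_cast this

/-- PROVED: no two angles of positions `≥ 1` add up to `2π` (`q q' = Q + 3/2` is impossible). [folklore] -/
theorem samplingAngle_add_ne_two_pi (Q : ℕ) {q q' : ℕ} (hq : 1 ≤ q) (hq' : 1 ≤ q') :
    samplingAngle Q q + samplingAngle Q q' ≠ 2 * π := by
  intro h
  unfold samplingAngle at h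
  have hℓ := samplingLog_pos Q
  rw [← add_div, div_eq_iff hℓ.ne', ← mul_add] at h
  have h' : Real.log q + Real.log q' = samplingLog Q := mul_left_cancel₀ (by positivity : (2 : ℝ) * π ≠ 0) h
  have hqpos : (0 : ℝ) < q := by exact_mod_cast hq
  have hq'pos : (0 : ℝ) < q' := by exact_mod_cast hq'
  rw [← Real.log_mul hqpos.ne' hq'pos.ne', samplingLog] at h'
  have hprod : (q : ℝ) * q' = Q + 3 / 2 :=
    Real.log_injOn_pos (Set.mem_Ioi.2 (mul_pos hqpos hq'pos))
      (Set.mem_Ioi.2 (by linarith [one_lt_samplingTop Q])) h'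
  have hnat : ((2 * (q * q') : ℕ) : ℝ) = ((2 * Q + 3 : ℕ) : ℝ) := by push_cast; linarith
  have := Nat.cast_injective hnat
  generalize q * q' = m at this
  omega

/-- PROVED: the first row of Connes' even basis matrix: `θ_{0m}(y) = −sin(2π m y/L)/(√2 π m)` for `m ≠ 0`. [folklore] -/
theorem thetaEven_row_zero_apply (L : ℝ) {m : ℕ} (hm : m ≠ 0) (y : ℝ) :
    thetaEven L 0 m y = -Real.sin (2 * π * m * y / L) / (Real.sqrt 2 * π * m) := by
  unfold thetaEven
  rw [if_neg (by simp [hm]), if_pos rfl]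

/-- PROVED: at the sampling window, `θ_{0N}(log q) = −sin(N ω_q)/(√2 π N)`. [folklore] -/
theorem thetaEven_samplingWindow_row_zero (Q : ℕ) {N : ℕ} (hN : N ≠ 0) (q : ℕ) :
    thetaEven (2 * (samplingWindow Q N).a) 0 N (Real.log q)
      = -Real.sin (N * samplingAngle Q q) / (Real.sqrt 2 * π * N) := by
  rw [thetaEven_row_zero_apply _ hN, two_mul_samplingWindow_a,
    show 2 * π * (N : ℝ) * Real.log q / samplingLog Q = N * samplingAngle Q q by unfold samplingAngle; ring]

/-- PROVED: the entrywise difference of two arithmetic data is a prime-pattern sum: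
`(d_w − d_{w₀})_{nm} = −2 Σ_{q in range} (w − w₀)(q) θ_{nm}(log q)`. [folklore] -/
theorem datumOf_sub_entry (w w₀ : Weights) (win : Window) (n m : Fin (win.N + 1)) :
    datumOf w win n m - datumOf w₀ win n m
      = -2 * ∑ q ∈ primeRange (2 * win.a), (w q - w₀ q) * thetaEven (2 * win.a) n m (Real.log q) := by
  have hs : ∑ q ∈ primeRange (2 * win.a), (w q - w₀ q) * thetaEven (2 * win.a) n m (Real.log q)
      = ∑ q ∈ primeRange (2 * win.a), w q * thetaEven (2 * win.a) n m (Real.log q)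
        - ∑ q ∈ primeRange (2 * win.a), w₀ q * thetaEven (2 * win.a) n m (Real.log q) := by
    rw [← Finset.sum_sub_distrib]
    exact Finset.sum_congr rfl fun q _ => by ring
  rw [hs]
  simp only [datumOf, evenBlock, weil, WP]
  ring

/-! ## §2 The height-`Q` sampling lemma (Vandermonde) and the lag-`0` slots -/

/-- **PROVED — HEIGHT-`Q` SAMPLING LEMMA.** If the `(0, N)` entries of `d_w − d_{w₀}` at the sampling windows of
order `Q` are `< ρ_N` with `N ρ_N → 0`, then `w(q) = w₀(q)` for EVERY position `2 ≤ q ≤ Q + 1`. [folklore] -/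
theorem weights_eq_of_close_at_samplingWindows {Q : ℕ} {ρ : ℕ → ℝ}
    (hρ : Tendsto (fun N : ℕ => (N : ℝ) * ρ N) atTop (𝓝 0)) {w w₀ : Weights}
    (hclose : ∀ N : ℕ, |datumOf w (samplingWindow Q N) 0 (Fin.last N)
      - datumOf w₀ (samplingWindow Q N) 0 (Fin.last N)| < ρ N)
    {q : ℕ} (hq2 : 2 ≤ q) (hqQ : q ≤ Q + 1) : w q = w₀ q := by
  classical
  -- Step 1: the sampled sine sums tend to zero
  have hg : Tendsto (fun N : ℕ => ∑ q ∈ Finset.range (Q + 2), (w q - w₀ q) * Real.sin (N * samplingAngle Q q))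
      atTop (𝓝 0) := by
    have hbound : ∀ N : ℕ, 1 ≤ N → ‖∑ q ∈ Finset.range (Q + 2), (w q - w₀ q) * Real.sin (N * samplingAngle Q q)‖
        ≤ Real.sqrt 2 * π / 2 * ((N : ℝ) * ρ N) := by
      intro N hN
      have hN0 : N ≠ 0 := by omega
      have hentry : datumOf w (samplingWindow Q N) 0 (Fin.last N) - datumOf w₀ (samplingWindow Q N) 0 (Fin.last N)
          = 2 / (Real.sqrt 2 * π * N)
            * ∑ q ∈ Finset.range (Q + 2), (w q - w₀ q) * Real.sin (N * samplingAngle Q q) := by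
        rw [datumOf_sub_entry, primeRange_samplingWindow, Finset.mul_sum, Finset.mul_sum]
        refine Finset.sum_congr rfl fun q _ => ?_
        rw [Fin.val_zero, Fin.val_last, thetaEven_samplingWindow_row_zero Q hN0 q]
        ring
      have hS : ∑ q ∈ Finset.range (Q + 2), (w q - w₀ q) * Real.sin (N * samplingAngle Q q)
          = Real.sqrt 2 * π * N / 2 * (datumOf w (samplingWindow Q N) 0 (Fin.last N)
            - datumOf w₀ (samplingWindow Q N) 0 (Fin.last N)) := by
        have hc : Real.sqrt 2 * π * N / 2 * (2 / (Real.sqrt 2 * π * N)) = 1 := by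
          field_simp
        rw [hentry, ← mul_assoc, hc, one_mul]
      rw [Real.norm_eq_abs, hS, abs_mul, abs_of_pos (by positivity : (0 : ℝ) < Real.sqrt 2 * π * N / 2)]
      calc Real.sqrt 2 * π * N / 2 * |datumOf w (samplingWindow Q N) 0 (Fin.last N)
              - datumOf w₀ (samplingWindow Q N) 0 (Fin.last N)|
          ≤ Real.sqrt 2 * π * N / 2 * ρ N := mul_le_mul_of_nonneg_left (hclose N).le (by positivity)
        _ = Real.sqrt 2 * π / 2 * ((N : ℝ) * ρ N) := by ring
    refine squeeze_zero_norm' (eventually_atTop.2 ⟨1, hbound⟩) ?_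
    simpa using hρ.const_mul (Real.sqrt 2 * π / 2)
  -- Step 2: drop the lag-0 slots `q = 0, 1` and pass to the index type `Icc 2 (Q+1)`
  have hg' : Tendsto (fun N : ℕ => ∑ k : ↥(Finset.Icc 2 (Q + 1)),
      (w k - w₀ k) * Real.sin (N * samplingAngle Q k)) atTop (𝓝 0) := by
    refine hg.congr fun N => ?_
    rw [Finset.sum_coe_sort (Finset.Icc 2 (Q + 1)) (fun q => (w q - w₀ q) * Real.sin (N * samplingAngle Q q))]
    refine (Finset.sum_subset (fun q hq => ?_) (fun q hq hq' => ?_)).symm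
    · rw [Finset.mem_Icc] at hq; rw [Finset.mem_range]; omega
    · rw [Finset.mem_range] at hq
      rw [Finset.mem_Icc] at hq'
      rcases (show q = 0 ∨ q = 1 by omega) with rfl | rfl
      · rw [samplingAngle_zero, mul_zero, Real.sin_zero, mul_zero]
      · rw [samplingAngle_one, mul_zero, Real.sin_zero, mul_zero]
  -- Step 3: the node hypotheses of the sine-sum vanishing lemma
  have hI : ∀ k : ↥(Finset.Icc 2 (Q + 1)), 2 ≤ (k : ℕ) ∧ (k : ℕ) ≤ Q + 1 := fun k => Finset.mem_Icc.1 k.2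
  have hω : ∀ k : ↥(Finset.Icc 2 (Q + 1)), 0 < samplingAngle Q k ∧ samplingAngle Q k < 2 * π := fun k =>
    ⟨samplingAngle_pos Q (hI k).1, samplingAngle_lt_two_pi Q (hI k).2⟩
  have hinj : Function.Injective fun k : ↥(Finset.Icc 2 (Q + 1)) => samplingAngle Q k := fun k l h =>
    Subtype.ext (samplingAngle_inj Q (by linarith [(hI k).1]) (by linarith [(hI l).1]) h)
  have hsum : ∀ k l : ↥(Finset.Icc 2 (Q + 1)), samplingAngle Q k + samplingAngle Q l ≠ 2 * π := fun k l =>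
    samplingAngle_add_ne_two_pi Q (by linarith [(hI k).1]) (by linarith [(hI l).1])
  have hc := sinSum_coeff_eq_zero (ω := fun k : ↥(Finset.Icc 2 (Q + 1)) => samplingAngle Q k)
    (c := fun k => w k - w₀ k) hω hinj hsum hg'
  have := congrFun hc ⟨q, Finset.mem_Icc.2 ⟨hq2, hqQ⟩⟩
  exact sub_eq_zero.1 this

/-- PROVED: the order-`0` window sees only the lag-`0` slots: its `(0,0)` entry difference is `−2 ((w − w₀)(0) + (w − w₀)(1))`. [folklore] -/
theorem datumOf_sub_samplingWindow_zero (w w₀ : Weights) (N : ℕ) :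
    datumOf w (samplingWindow 0 N) 0 0 - datumOf w₀ (samplingWindow 0 N) 0 0
      = -2 * (w 0 + w 1 - (w₀ 0 + w₀ 1)) := by
  have hL : 2 * (samplingWindow 0 N).a ≠ 0 := by rw [two_mul_samplingWindow_a]; exact (samplingLog_pos 0).ne'
  rw [datumOf_sub_entry, primeRange_samplingWindow, Fin.val_zero]
  simp only [Finset.sum_range_succ, Finset.sum_range_zero, Nat.cast_zero, Real.log_zero, Nat.cast_one,
    Real.log_one, thetaEven_zero_zero, sub_zero, div_self hL, zero_add]
  ring

/-- PROVED: if the `(0,0)` entries at the order-`0` windows are `< ρ_N → 0` then `w(0) + w(1) = w₀(0) + w₀(1)`. [folklore] -/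
theorem weights_sum01_eq_of_close {ρ : ℕ → ℝ} (hρ : Tendsto ρ atTop (𝓝 0)) {w w₀ : Weights}
    (hclose : ∀ N : ℕ, |datumOf w (samplingWindow 0 N) 0 0 - datumOf w₀ (samplingWindow 0 N) 0 0| < ρ N) :
    w 0 + w 1 = w₀ 0 + w₀ 1 := by
  have hle : |-2 * (w 0 + w 1 - (w₀ 0 + w₀ 1))| ≤ 0 :=
    ge_of_tendsto hρ (Filter.Eventually.of_forall fun N => by
      rw [← datumOf_sub_samplingWindow_zero w w₀ N]; exact (hclose N).le)
  have := abs_nonpos_iff.1 hle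
  linarith

/-- PROVED: the datum sees the weight table only through `w(q)`, `q ≥ 2`, and the lag-`0` sum `w(0) + w(1)`. [folklore] -/
theorem datumOf_eq_of_weights_eq {w w₀ : Weights} (h2 : ∀ q, 2 ≤ q → w q = w₀ q)
    (h01 : w 0 + w 1 = w₀ 0 + w₀ 1) : datumOf w = datumOf w₀ := by
  classical
  funext win
  ext n m
  rw [← sub_eq_zero, datumOf_sub_entry]
  have hL : 0 < 2 * win.a := by linarith [win.ha]
  have hsub : ({0, 1} : Finset ℕ) ⊆ primeRange (2 * win.a) := by
    intro q hq
    rw [Finset.mem_insert, Finset.mem_singleton] at hq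
    rcases hq with rfl | rfl <;> exact mem_primeRange_of_log_le (by simpa using win.ha.le)
  rw [← Finset.sum_subset hsub (fun q _ hq => by
    rw [Finset.mem_insert, Finset.mem_singleton, not_or] at hq
    rw [h2 q (by omega), sub_self, zero_mul])]
  rw [Finset.sum_pair (by norm_num : (0 : ℕ) ≠ 1)]
  simp only [Nat.cast_zero, Real.log_zero, Nat.cast_one, Real.log_one]
  rw [← add_mul, show w 0 - w₀ 0 + (w 1 - w₀ 1) = 0 by linarith, zero_mul, mul_zero]

/-! ## §3 The trace theorem for thin profiles -/

/-- THIN ALONG THE SAMPLING FAMILY: `N · r(samplingWindow Q N) → 0` (as `N → ∞`) for every order `Q`. [folklore] -/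
def ThinAtSamplingHeights (r : Window → ℝ) : Prop :=
  ∀ Q : ℕ, Tendsto (fun N : ℕ => (N : ℝ) * r (samplingWindow Q N)) atTop (𝓝 0)

/-- PROVED: `N ρ_N → 0` with `ρ ≥ 0` gives `ρ_N → 0`. [folklore] -/
theorem tendsto_zero_of_thin {ρ : ℕ → ℝ} (h : Tendsto (fun N : ℕ => (N : ℝ) * ρ N) atTop (𝓝 0))
    (hρ : ∀ N, 0 ≤ ρ N) : Tendsto ρ atTop (𝓝 0) := by
  refine squeeze_zero_norm' (eventually_atTop.2 ⟨1, fun N hN => ?_⟩) h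
  rw [Real.norm_eq_abs, abs_of_nonneg (hρ N)]
  exact le_mul_of_one_le_left (hρ N) (by exact_mod_cast hN)

/-- **PROVED — TRACE THEOREM.** An arithmetic datum inside a thin entry tube about an arithmetic datum IS the centre:
`datumOf w ∈ entryTube r (datumOf w₀)` with `r` thin along the sampling family ⟹ `datumOf w = datumOf w₀`. [folklore] -/
theorem datumOf_eq_of_mem_entryTube_of_thin {r : Window → ℝ} (hr : ThinAtSamplingHeights r) {w w₀ : Weights}
    (h : datumOf w ∈ entryTube r (datumOf w₀)) : datumOf w = datumOf w₀ := by
  have hclose : ∀ win : Window, ∀ i j : Fin (win.N + 1), |datumOf w win i j - datumOf w₀ win i j| < r win :=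
    fun win i j => h win i j
  refine datumOf_eq_of_weights_eq (fun q hq => ?_) ?_
  · exact weights_eq_of_close_at_samplingWindows (Q := q) (ρ := fun N => r (samplingWindow q N)) (hr q)
      (fun N => hclose (samplingWindow q N) 0 (Fin.last N)) hq (by omega)
  · exact weights_sum01_eq_of_close (ρ := fun N => r (samplingWindow 0 N))
      (tendsto_zero_of_thin (hr 0) fun N => (abs_nonneg _).trans (hclose (samplingWindow 0 N) 0 0).le)
      fun N => hclose (samplingWindow 0 N) 0 0

/-- PROVED: the dial-space TRACE of a thin tube about `ζ` is `{ζ}`. [folklore] -/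
theorem entryTube_zeta_inter_dialSpace {r : Window → ℝ} (hr : ThinAtSamplingHeights r) {d : Datum}
    (hd : d ∈ dialSpace) (hdT : d ∈ entryTube r zetaDatum) : d = zetaDatum := by
  obtain ⟨w, rfl⟩ := hd
  exact datumOf_eq_of_mem_entryTube_of_thin (w₀ := zetaWeights) hr hdT

/-- The THIN PROFILE `r(win) = 1/(N+1)²`. [folklore] -/
def thinProfile : Window → ℝ := fun win => 1 / ((win.N : ℝ) + 1) ^ 2

/-- PROVED: positive. [folklore] -/
theorem thinProfile_pos (win : Window) : 0 < thinProfile win := by unfold thinProfile; positivity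

/-- PROVED: thin along the sampling family (`N/(N+1)² ≤ 1/(N+1) → 0`). [folklore] -/
theorem thinAtSamplingHeights_thinProfile : ThinAtSamplingHeights thinProfile := by
  intro Q
  refine squeeze_zero (fun N => by unfold thinProfile; positivity) (fun N => ?_)
    tendsto_one_div_add_atTop_nhds_zero_nat
  show (N : ℝ) * (1 / (((samplingWindow Q N).N : ℝ) + 1) ^ 2) ≤ 1 / ((N : ℝ) + 1)
  rw [samplingWindow_N, mul_one_div, div_le_div_iff₀ (by positivity) (by positivity)]
  nlinarith

/-! ## §4 Headline: G1-cont existence on dial domains ≡ all-window positivity of `ζ` -/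

/-- PROVED: under all-window positivity of `ζ`, a thin tube about `ζ` separates `ζ` from the negatives of any dial
domain (its trace is `{ζ}`, which is then not negative). [folklore] -/
theorem separates_entryTube_zeta_of_thin {r : Window → ℝ} (hr : ThinAtSamplingHeights r)
    (hr0 : ∀ win, 0 < r win) {D : Set Datum} (hD : D ⊆ dialSpace) (hpos : AllWindowsPositive zetaDatum) :
    Separates (entryTube r zetaDatum) D zetaDatum := by
  refine ⟨mem_entryTube_self hr0 _, fun d hd hneg hdT => ?_⟩
  rw [entryTube_zeta_inter_dialSpace hr (hD hd) hdT] at hneg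
  exact (detectablyNegative_iff_not_allWindowsPositive _).1 hneg hpos

/-- **PROVED — HEADLINE (G1-cont EXISTENCE ≡ `𝒫`-MEMBERSHIP OF `ζ` on dial domains).** For `ζ ∈ D ⊆ dialSpace`:
a G1-cont criterion separating `ζ` from the negatives of `D` EXISTS iff `ζ` is all-window positive. RH-free; both
sides OPEN. [folklore] -/
theorem exists_inG1cont_separates_iff_allWindowsPositive {D : Set Datum} (hζ : zetaDatum ∈ D)
    (hD : D ⊆ dialSpace) : (∃ S, InG1cont S ∧ Separates S D zetaDatum) ↔ AllWindowsPositive zetaDatum :=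
  ⟨fun ⟨_, _, hS⟩ => hS.allWindowsPositive hζ, fun h =>
    ⟨_, inG1cont_entryTube thinProfile_pos _,
      separates_entryTube_zeta_of_thin thinAtSamplingHeights_thinProfile thinProfile_pos hD h⟩⟩

/-- PROVED: the same for window-wise open criteria. [folklore] -/
theorem exists_windowwiseOpen_separates_iff_allWindowsPositive {D : Set Datum} (hζ : zetaDatum ∈ D)
    (hD : D ⊆ dialSpace) : (∃ S, IsWindowwiseOpen S ∧ Separates S D zetaDatum) ↔ AllWindowsPositive zetaDatum :=
  ⟨fun ⟨_, _, hS⟩ => hS.allWindowsPositive hζ, fun h =>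
    ⟨_, isWindowwiseOpen_entryTube thinProfile _,
      separates_entryTube_zeta_of_thin thinAtSamplingHeights_thinProfile thinProfile_pos hD h⟩⟩

/-- PROVED: `BoxIsolated D ζ ↔ AllWindowsPositive ζ` on dial domains. [folklore] -/
theorem boxIsolated_iff_allWindowsPositive {D : Set Datum} (hζ : zetaDatum ∈ D) (hD : D ⊆ dialSpace) :
    BoxIsolated D zetaDatum ↔ AllWindowsPositive zetaDatum :=
  (exists_inG1cont_separates_iff D zetaDatum).symm.trans (exists_inG1cont_separates_iff_allWindowsPositive hζ hD)

/-- PROVED: on the arithmetic domain of record `arithDialSpace`. [folklore] -/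
theorem exists_inG1cont_separates_arithDialSpace_iff :
    (∃ S, InG1cont S ∧ Separates S arithDialSpace zetaDatum) ↔ AllWindowsPositive zetaDatum :=
  exists_inG1cont_separates_iff_allWindowsPositive zetaDatum_mem_arithDialSpace arithDialSpace_subset_dialSpace

/-- **PROVED — T0 WITHOUT `𝒫 ∈ 𝒞`.** The barrier schema `(∃ S ∈ 𝒞, Separates S D ζ) ↔ AllWindowsPositive ζ`
holds for EVERY class `𝒞` containing the thin tube about `ζ`, on every dial domain `D ∋ ζ` (compare
`pfPersistence_criterion_in_C_iff_weilPositivity`, which needs `positiveClass ∈ 𝒞`). [folklore] -/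
theorem barrier_schema_iff_of_thinTube_mem {𝒞 : Set (Set Datum)} (h𝒞 : entryTube thinProfile zetaDatum ∈ 𝒞)
    {D : Set Datum} (hζ : zetaDatum ∈ D) (hD : D ⊆ dialSpace) :
    (∃ S ∈ 𝒞, Separates S D zetaDatum) ↔ AllWindowsPositive zetaDatum :=
  ⟨fun ⟨_, _, hS⟩ => hS.allWindowsPositive hζ, fun h =>
    ⟨_, h𝒞, separates_entryTube_zeta_of_thin thinAtSamplingHeights_thinProfile thinProfile_pos hD h⟩⟩

/-! ## §5 The U-clause kills thin tubes -/

/-- **PROVED — `DialEscape` FAILS FOR THIN TUBES.** If `N · r(samplingWindow 1 N) → 0` then the `2`-dial cannot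
escape below height `log(5/2)/2` inside `entryTube r ζ`: an escaping member would agree with `pDial 2 K` (`K ≠ 1`)
at every order-`1` sampling window, and the sampling lemma forces `K ζ_w(2) = ζ_w(2)`. [folklore] -/
theorem not_dialEscape_entryTube_of_thin {r : Window → ℝ}
    (hr1 : Tendsto (fun N : ℕ => (N : ℝ) * r (samplingWindow 1 N)) atTop (𝓝 0)) (hr0 : ∀ win, 0 < r win) :
    ¬ DialEscape (entryTube r zetaDatum) := by
  intro hesc
  obtain ⟨hp, -⟩ := hesc (mem_entryTube_self hr0 _)
  have hev := hp 2 Nat.prime_two (samplingWindow 1 0).a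
  obtain ⟨K, ⟨d, hdT, hdK⟩, hK⟩ := (hev.and self_mem_nhdsWithin).exists
  have hK1 : K ≠ 1 := by simpa using hK
  have hclose : ∀ N : ℕ, |datumOf (dial 2 K zetaWeights) (samplingWindow 1 N) 0 (Fin.last N)
      - datumOf zetaWeights (samplingWindow 1 N) 0 (Fin.last N)| < r (samplingWindow 1 N) := by
    intro N
    have hwin : samplingWindow 1 N ∈ below (samplingWindow 1 0).a :=
      show (samplingWindow 1 N).a ≤ (samplingWindow 1 0).a from le_rfl
    have h := hdT (samplingWindow 1 N) 0 (Fin.last N)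
    rw [← hdK _ hwin] at h
    exact h
  have h2 := weights_eq_of_close_at_samplingWindows (Q := 1) (ρ := fun N => r (samplingWindow 1 N)) hr1 hclose
    (q := 2) le_rfl (by norm_num)
  have hd : dial 2 K zetaWeights 2 = K * zetaWeights 2 := by simp [dial]
  rw [hd] at h2
  have hz : zetaWeights 2 ≠ 0 := (zetaWeights_pos_of_prime Nat.prime_two).ne'
  exact hK1 (mul_right_cancel₀ hz (h2.trans (one_mul _).symm))

/-- PROVED: hence a thin entry tube is never in G1-contU; a G1-contU entry tube has its radius NOT `o(1/N)` along
the order-`1` sampling family (height floors are necessary). [folklore] -/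
theorem not_inG1contU_entryTube_of_thin {r : Window → ℝ}
    (hr1 : Tendsto (fun N : ℕ => (N : ℝ) * r (samplingWindow 1 N)) atTop (𝓝 0)) (hr0 : ∀ win, 0 < r win) :
    ¬ InG1contU (entryTube r zetaDatum) := fun h => not_dialEscape_entryTube_of_thin hr1 hr0 h.2

/-- PROVED: in particular the thin-profile witness of §4 is G1-cont but NOT G1-contU. [folklore] -/
theorem thinProfile_tube_inG1cont_not_inG1contU :
    InG1cont (entryTube thinProfile zetaDatum) ∧ ¬ InG1contU (entryTube thinProfile zetaDatum) :=
  ⟨inG1cont_entryTube thinProfile_pos _,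
    not_inG1contU_entryTube_of_thin (thinAtSamplingHeights_thinProfile 1) thinProfile_pos⟩

end Summit.RiemannHypothesis.RiemannHypothesis.Theorems.PfPersistence

end
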